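import Summits.QuantumFields.YangMills.Theorems.UnitScaleTiltProp7CombLevelMassMemberT3Letters
import HarnessLib

/-!
# Route `UnitScaleTilt`, crux K1 «MinimiserStabilityRegPr» (stmt-QuantumFields-19200), route-R E′ (A′)-on-Σ, P-A2 (β), row «(n3)-comb» —
# (O2) GROUNDWORK, file F-8c-final-2a: THE FROZEN LETTERS OF THE `hMc` KNIT, PACKAGED (pure reals)

«(O2) groundwork — not consumed by any displayed row before the freeze lifts» (★★OWNER `ym3-torus-plan` g29∕g30 RULINGS №20 (2), №22 (c) «(II) GO»).
Cell `ym3-torus`, D-0154 (3c) R3 twin-width seat `ym-routeR-w1` (gen 10); pen F-8c-final-2 «`hMcomb_holds`» (pens of record 2026-08-29 12:17Z SWAP: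
knit routeR-w1 g10, F-8b-5b ★routeR-w6 g9 ∕ w3-19200 g14).  THEOREMS ONLY (0 `def`, 0 `sorry`); Mathlib-only via ✓p719670 `…CombLevelMassMemberT3Letters`;
`--supports stmt-QuantumFields-19200 --as helper`, count-neutral.  YM₃ on T³ is a ladder rung (R3), not the Clay problem; nothing here claims `hMcomb`, (β), `hPA2`,
the stub, the crux, d = 4 or the mass gap.

THE POINT.  ✓`Prop7CombLevelMassMemberT3Letters.windows_at_eC` states its letters as `let`s; the knit wants them as OPAQUE letters with defining equations (so that the
member proof rewrites `θ′C`, `θgC`, `θ₂C`, `cB1C` BY NAME after `(F.P K).d = 3`, `(F.P K).L = L`, and never unfolds a `min`).  ★`frozen_letters` is that repackaging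
at `d = 3`: `∃ eC ε₀C δC θ′C θgC θ₂C cB1C`, their six defining equations (texts = `windows_at_eC 3`'s `let` values, `d`-casts spelled `((3 : ℕ) : ℝ)`), `0 < eC`,
`0 < ρ < 1` at `ρ = (√L)⁻¹`, the four nonnegativities, F-8b-4 v2's `hsmall`∕`hsmallS` in their literal letters, and the six radius rows at every `0 < e ≤ eC`.
HONEST SCOPE.  One `obtain` + `exact ⟨…, rfl, …⟩`; no analysis; nothing of F-8b∕F-8c-final is proved here.

References: T. Bałaban, CMP **102** (1985) 277–309 [Balaban1985Variational] ((2) p.278, (14) p.280, (19) p.281); CMP **98** (1985) 17–51 [Balaban1985Averaging]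
(Prop. 3 (122)–(126) p.36); CMP **109** (1987) 249–301 [Balaban1987RG1] ((0.4) p.253).
-/

set_option autoImplicit false

noncomputable section

namespace Summit.QuantumFields.YangMills.Theorems.Prop7CombHMcombFrozenLetters

open Summit.QuantumFields.YangMills.Theorems.Prop7CombLevelMassMemberT3Letters (windows_at_eC)

/-- **THE FROZEN LETTERS OF THE KNIT** — ✓`Prop7CombLevelMassMemberT3Letters.windows_at_eC` at `d = 3`, repackaged as an `∃` over opaque letters
`eC ε₀C δC θ′C θgC θ₂C cB1C` with their defining equations (so the member proof rewrites by name, never by unfolding). [cite: Balaban1985Variational, (2) p.278, (14) p.280, (19) p.281] -/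
theorem frozen_letters (L B₁' wN wS ΘM : ℝ) (hL : 1 < L) (hB : 0 < B₁') (hwS : 0 ≤ wS) :
    ∃ eC ε₀C δC θ'C θgC θ₂C cB1C : ℝ,
      0 < eC ∧ ε₀C = (12 * B₁' + 1) * eC ∧ δC = 2 * B₁' * eC ∧
      θ'C = 210 * ((2 * ((3 : ℕ) : ℝ) + 2) * L) * (2 * (8 * (((3 : ℕ) : ℝ) + 1) * (((3 : ℕ) : ℝ) + 4) * L ^ 2 * (2 * (2 * ε₀C)))) * Real.sqrt (2 * ((3 : ℕ) : ℝ)) ∧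
      θgC = (24 * (2 * (8 * (((3 : ℕ) : ℝ) + 1) * (((3 : ℕ) : ℝ) + 4) * L ^ 2 * (2 * (2 * ε₀C)))) + 8 * ((((3 : ℕ) : ℝ) + 2) * L) ^ 2 * (2 * (2 * ε₀C)))
              * Real.sqrt (((3 : ℕ) : ℝ) * (L ^ 2 * (L ^ (3 : ℕ))⁻¹))
            + 210 * ((2 * ((3 : ℕ) : ℝ) + 2) * L) * (2 * (8 * (((3 : ℕ) : ℝ) + 1) * (((3 : ℕ) : ℝ) + 4) * L ^ 2 * (2 * (2 * ε₀C)))) * Real.sqrt (8 * ((3 : ℕ) : ℝ) ^ 2) ∧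
      θ₂C = 260 * (9360 * L ^ 3 * δC) * ((2 * ((3 : ℕ) : ℝ) + 2) * L) * Real.sqrt (2 * ((3 : ℕ) : ℝ)) ∧
      cB1C = Real.sqrt (2 * (wN * ((Real.sqrt L)⁻¹ / (1 - (Real.sqrt L)⁻¹))
              + (ΘM + 3 * wS * θ₂C ^ 2) * ((Real.sqrt L)⁻¹ ^ 5 / (1 - (Real.sqrt L)⁻¹ ^ 5)))) ∧
      (0 < (Real.sqrt L)⁻¹ ∧ (Real.sqrt L)⁻¹ < 1) ∧ (0 ≤ θ'C ∧ 0 ≤ θgC ∧ 0 ≤ θ₂C ∧ 0 ≤ cB1C) ∧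
      Real.exp (θ'C * ((Real.sqrt L)⁻¹ ^ 3 / (1 - (Real.sqrt L)⁻¹ ^ 4))) * θ₂C * (1 + cB1C) * ((Real.sqrt L)⁻¹ ^ 3 / (1 - (Real.sqrt L)⁻¹ ^ 4)) ≤ 1 / 2 ∧
      12 * wS * θ₂C ^ 2 * ((Real.sqrt L)⁻¹ / (1 - (Real.sqrt L)⁻¹)) ≤ 1 / 2 ∧
      ∀ e : ℝ, 0 < e → e ≤ eC →
        10 ^ 7 * L ^ 3 * ((12 * B₁' + 1) * e) ≤ 1 ∧ 2 * B₁' * e ≤ ((12 * B₁' + 1) * e) / 6 ∧ 0 ≤ 2 * B₁' * e ∧ e ≤ (12 * B₁' + 1) * e ∧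
          (12 * B₁' + 1) * e ≤ ε₀C ∧ 2 * B₁' * e ≤ δC := by
  obtain ⟨heC, hρ, hnn, hsmall, hsmallS, hrad⟩ := windows_at_eC 3 (wN := wN) (ΘM := ΘM) hL hB hwS
  exact ⟨_, _, _, _, _, _, _, heC, rfl, rfl, rfl, rfl, rfl, rfl, hρ, hnn, hsmall, hsmallS, hrad⟩

end Summit.QuantumFields.YangMills.Theorems.Prop7CombHMcombFrozenLetters

end
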